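import Summits.HodgeConjecture.HodgeConjecture.Theses.NikulinTwinTransport
import Summits.HodgeConjecture.HodgeConjecture.Theorems.NikulinTwinTransportTwinSimilitudeAlgebraic
import Literature.AlgebraicGeometry.Surfaces.K3Marking
import Literature.AlgebraicGeometry.Surfaces.K3HodgeTypesHolds
import Literature.AlgebraicGeometry.HodgeTheory.HodgeIndexSurface
import Literature.AlgebraicGeometry.HodgeTheory.ComplexGysinCorrespondence
import Summits.HodgeConjecture.HodgeConjecture.Theorems.NikulinTwinTransportRealMultiplicationFibreIntegral
import Literature.AlgebraicGeometry.HodgeTheory.GysinBaseChange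
import HarnessLib

/-!
# Route NikulinTwinTransport · crux `TwinSimilitudeAlgebraic` (stmt-HodgeConjecture-13674) —
# stub `stub_divisorCorrections` of line `hyperkaehler-nikulin-anchors` (reshape r1)

The line `hyperkaehler-nikulin-anchors` completes a partial algebraic twin class
`Φ = [γ]_* : H²(S) → H²(Sg)` between two projective K3 surfaces into a full algebraic
`2`-similitude `Ψ₀ = Φ + Σᵢ νᵢ` by rank-one corrections `νᵢ : x ↦ (x.aᵢ) bᵢ` with `aᵢ ∈ NS(S)`,
`bᵢ ∈ NS(Sg)` divisor classes; the corrections must themselves be actions of ALGEBRAIC classes on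
`Sg ⊗ S`. This file proves exactly that, the registered stub `stub_divisorCorrections`: for
algebraic divisor classes `a ∈ N¹H²(S)`, `b ∈ N¹H²(Sg)` and `p ≠ 0` in `H⁴(S(ℂ); ℂ)`, the class
`γ = c⁻¹ · pr_{Sg}^* b ∪ pr_S^* a ∈ N²H⁴((Sg ⊗ S)(ℂ))` (algebraic as an exterior product of
divisor classes, `cupProduct_fst_snd_mem_algebraicClasses_of_eq`) acts as `x ↦ t · b` whenever
`x ∪ a = t · p`:
`pr_{Sg*}(pr_S^* x ∪ pr_{Sg}^* b ∪ pr_S^* a) = pr_{Sg*}(pr_{Sg}^* b ∪ pr_S^*(x ∪ a))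
  = b ∪ pr_{Sg*} pr_S^* (t p) = t c · b`
(graded commutativity, associativity and naturality of `∪`, the projection formula
`complexGysin_cup`, and FIBRE INTEGRATION `pr_{Sg*}(pr_S^* p) = c · 1_{Sg}`, `c ≠ 0`, which is
`fibreIntegral_of_kunnethTop` fed with the Künneth spanning property `kunnethSpan_complexBetti`
of the tree). It is the two-surface version of the landed
`divisorCorrespondence_of_fibreIntegral` (file
`NikulinTwinTransportRealMultiplicationDivisorCorrespondences`), with the fibre integral
discharged. Everything is proved; no named facts, no definitions.

## References

* [Fulton1998] W. Fulton, Intersection Theory, 2nd ed., Springer 1998, §16.1.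
* [FultonYoungTableaux1997] W. Fulton, Young Tableaux, CUP 1997, Appendix B §B.1 (3)–(6).
* [VoisinHodgeII2003] C. Voisin, Hodge Theory and Complex Algebraic Geometry II, CUP 2003,
  §9.2.4 Prop. 9.20.
-/

noncomputable section

set_option linter.dupNamespace false

open CategoryTheory MonoidalCategory
open scoped Manifold Matrix
open Literature.AlgebraicGeometry.Motives Literature.AlgebraicGeometry.HodgeTheory
open Literature.AlgebraicGeometry.Surfaces Literature.Geometry.Kaehler
open Literature.AlgebraicTopology.SingularHomology
open Summit.HodgeConjecture.HodgeConjecture.Theses.NikulinTwinTransport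

namespace Summit.HodgeConjecture.HodgeConjecture.Theorems.NikulinTwinTransport

/-! ## Local notations — VERBATIM those of the registered skeleton
`Cruxes/TwinSimilitudeAlgebraic/Lines/hyperkaehler_nikulin_anchors.lean` (keep them byte-identical:
the gate matches the stub signature textually AND by elaboration) -/

/-- `Gen[S, p]`: `p` is an integral generator of `H⁴(S(ℂ); ℂ)` (the generator clause of X). Local notation
only. -/
local notation3 (prettyPrint := false) "Gen[" S ", " p "]" =>
  (IsIntegralClass p ∧ ∀ q : complexBetti S (2 * 2), IsIntegralClass q → ∃ n : ℤ, q = n • p)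

/-- `Corr[μ, S, S', hS, hS' ; γ, y] = [γ]_* y = fst_*(snd^* y ∪ γ)`, the action of
`γ ∈ H⁴((S ⊗ S′)(ℂ); ℂ)` as a correspondence `H²(S′) → H²(S)` (the FIRST factor receives). Local notation
only, verbatim from the route's Theorems files; for `hS hS'` the K3 witnesses it is definitionally the
inline term of the route items. -/
local notation3 (prettyPrint := false) "Corr[" μ ", " S ", " S' ", " hS ", " hS' " ; " γ ", " y "]" =>
  complexGysin μ
    (IsSmoothProjective.tensor_holds (IsK3Surface.isSmoothProjective hS)
      (IsK3Surface.isSmoothProjective hS'))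
    (IsK3Surface.isSmoothProjective hS) (SemiCartesianMonoidalCategory.fst S S')
    (rfl : 2 * 1 + 2 * 2 + 2 * 2 = 2 * 1 + 2 * (2 + 2))
    (cupProduct (rfl : 2 * 1 + 2 * 2 = 2 * 1 + 2 * 2)
      (complexBetti.map (SemiCartesianMonoidalCategory.snd S S') (2 * 1) y) γ)

/-- `CompCorr`: composition of algebraic degree-`2` correspondences between smooth projective surfaces
acts as an algebraic correspondence — hypothesis (C) of `twinSimilitudeAlgebraic_of_anchor`, verbatim
(the tree proves it from the multiplicativity `N² ∪ N² ⊆ N⁴`: `corrComp_surfaces_of_cup'`; route item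
`TwinAnchorGlue` is its packaged use). Local notation only. -/
local notation3 (prettyPrint := false) "CompCorr" =>
  ∀ (μ : OrientationFamily), μ.HasPoincareDuality →
    ∀ (A B C : SchemeOver ℂ) (hA : IsSmoothProjective 2 A) (hB : IsSmoothProjective 2 B)
      (hC : IsSmoothProjective 2 C),
      ∀ γ ∈ algebraicClasses (MonoidalCategoryStruct.tensorObj A B) 2,
        ∀ γ₁ ∈ algebraicClasses (MonoidalCategoryStruct.tensorObj B C) 2,
          ∃ γ₂ ∈ algebraicClasses (MonoidalCategoryStruct.tensorObj A C) 2,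
            ∀ x : complexBetti C (2 * 1),
              complexGysin μ (IsSmoothProjective.tensor_holds hA hC) hA
                  (SemiCartesianMonoidalCategory.fst A C)
                  (rfl : 2 * 1 + 2 * 2 + 2 * 2 = 2 * 1 + 2 * (2 + 2))
                  (cupProduct (rfl : 2 * 1 + 2 * 2 = 2 * 1 + 2 * 2)
                    (complexBetti.map (SemiCartesianMonoidalCategory.snd A C) (2 * 1) x) γ₂) =
                complexGysin μ (IsSmoothProjective.tensor_holds hA hB) hA
                  (SemiCartesianMonoidalCategory.fst A B)
                  (rfl : 2 * 1 + 2 * 2 + 2 * 2 = 2 * 1 + 2 * (2 + 2))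
                  (cupProduct (rfl : 2 * 1 + 2 * 2 = 2 * 1 + 2 * 2)
                    (complexBetti.map (SemiCartesianMonoidalCategory.snd A B) (2 * 1)
                      (complexGysin μ (IsSmoothProjective.tensor_holds hB hC) hB
                        (SemiCartesianMonoidalCategory.fst B C)
                        (rfl : 2 * 1 + 2 * 2 + 2 * 2 = 2 * 1 + 2 * (2 + 2))
                        (cupProduct (rfl : 2 * 1 + 2 * 2 = 2 * 1 + 2 * 2)
                          (complexBetti.map (SemiCartesianMonoidalCategory.snd B C) (2 * 1) x)
                          γ₁)))
                    γ)

/-- `Perp[S ; x]`: `x ∈ H²(S(ℂ); ℂ)` is TRANSCENDENTAL — cup-orthogonal to every divisor class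
`d ∈ NS(S) ⊗ ℂ = algebraicClasses S 1 = N¹H²` (for a projective K3 surface: `x ∈ T(S)_ℚ ⊗ ℂ`), spelled
exactly as in the route items (`TwinTransportRMPicardTwo`). Local notation only.
[cite: Huybrechts2016K3, Ch. 3 Def. 2.5] -/
local notation3 (prettyPrint := false) "Perp[" S " ; " x "]" =>
  ∀ d ∈ algebraicClasses S 1, cupProduct (rfl : 2 * 1 + 2 * 1 = 2 * 2) x d = 0

/-- `OutAnchor[μ, S, Sg, hS, hSg, p, pg]`: AN ALGEBRAIC OUT-ANCHOR `2`-SIMILITUDE AT `S` WITH PARTNER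
`Sg` — a `ℂ`-linear equivalence `Ψ : H²(S) ≃ H²(Sg)` which is algebraic (the action of an algebraic
class on `Sg ⊗ S`) and whose inverse is rational, type-preserving and HALVES the cup form
(`(u.v) = 2b·pg ⟹ (Ψ⁻¹u.Ψ⁻¹v) = b·p`).  Symbol for symbol the body of `AnchorData[μ, Sg, hSg, pg]`
(= the body of the route crux `TwinTwistorTransport` at `Sg`) with the partner `S″ := S`, `p″ := p`.
Local notation only. -/
local notation3 (prettyPrint := false)
    "OutAnchor[" μ ", " S ", " Sg ", " hS ", " hSg ", " p ", " pg "]" =>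
  ∃ Ψ : complexBetti S (2 * 1) ≃ₗ[ℂ] complexBetti Sg (2 * 1),
    (∀ y, IsRationalClass y → IsRationalClass (Ψ.symm y)) ∧
    (∀ (i j : ℕ) y, IsOfHodgeType 2 Sg (2 * 1) i j y →
      IsOfHodgeType 2 S (2 * 1) i j (Ψ.symm y)) ∧
    (∀ (u v : complexBetti Sg (2 * 1)) (b : ℂ),
      cupProduct (rfl : 2 * 1 + 2 * 1 = 2 * 2) u v = ((2 : ℂ) * b) • pg →
        cupProduct (rfl : 2 * 1 + 2 * 1 = 2 * 2) (Ψ.symm u) (Ψ.symm v) = b • p) ∧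
    ∃ γ ∈ algebraicClasses (MonoidalCategoryStruct.tensorObj Sg S) 2,
      ∀ x : complexBetti S (2 * 1), Ψ x = Corr[μ, Sg, S, hSg, hS ; γ, x]


/-- **Divisor corrections between two projective K3 surfaces are algebraic correspondences.**
For projective K3 surfaces `S`, `Sg`, a non-zero class `p ∈ H⁴(S(ℂ); ℂ)` and algebraic divisor
classes `a ∈ N¹H²(S)`, `b ∈ N¹H²(Sg)`, some algebraic `γ ∈ N²H⁴((Sg ⊗ S)(ℂ))` acts as the
rank-one map `x ↦ (x.a) b`: `[γ]_* x = pr_{Sg*}(pr_S^* x ∪ γ) = t · b` whenever `x ∪ a = t · p`.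
The class is `γ = c⁻¹ · pr_{Sg}^* b ∪ pr_S^* a`, where `pr_{Sg*}(pr_S^* p) = c · 1_{Sg}`, `c ≠ 0`
(fibre integration, `fibreIntegral_of_kunnethTop` with `kunnethSpan_complexBetti`); the
computation is the projection formula `complexGysin_cup` after graded commutativity,
associativity and naturality of the cup product. Two-surface version of
`divisorCorrespondence_of_fibreIntegral`. [cite: Fulton1998, §16.1]
[cite: FultonYoungTableaux1997, Appendix B §B.1 (3), (6)] -/
theorem stub_divisorCorrections :
    ∀ (μ : OrientationFamily), μ.HasPoincareDuality →
      ∀ (S Sg : SchemeOver ℂ) (hS : IsK3Surface S) (hSg : IsK3Surface Sg)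
        (p : complexBetti S (2 * 2)), p ≠ 0 →
        ∀ a ∈ algebraicClasses S 1, ∀ b ∈ algebraicClasses Sg 1,
          ∃ γ ∈ algebraicClasses (MonoidalCategoryStruct.tensorObj Sg S) 2,
            ∀ (x : complexBetti S (2 * 1)) (t : ℂ),
              cupProduct (rfl : 2 * 1 + 2 * 1 = 2 * 2) x a = t • p →
                Corr[μ, Sg, S, hSg, hS ; γ, x] = t • b := by
  intro μ hμ S Sg hS hSg p hp0 a ha b hb
  -- fibre integration `pr_{Sg*}(pr_S^* p) = c • 1_{Sg}`, `c ≠ 0`, from Künneth spanning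
  obtain ⟨c, hc, hκ⟩ := fibreIntegral_of_kunnethTop μ (IsK3Surface.isSmoothProjective hSg)
    (IsK3Surface.isSmoothProjective hS)
    (kunnethSpan_complexBetti (IsK3Surface.isSmoothProjective hSg)
      (IsK3Surface.isSmoothProjective hS) (2 * (2 + 2))) hp0
  -- the exterior product `γ₀ = pr_{Sg}^* b ∪ pr_S^* a`, algebraic
  set γ₀ : complexBetti (Sg ⊗ S) (2 * 2) := cupProduct (rfl : 2 * 1 + 2 * 1 = 2 * 2)
    (complexBetti.map (SemiCartesianMonoidalCategory.fst Sg S) (2 * 1) b)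
    (complexBetti.map (SemiCartesianMonoidalCategory.snd Sg S) (2 * 1) a) with hγ₀
  have hγ₀alg : γ₀ ∈ algebraicClasses (Sg ⊗ S) 2 :=
    cupProduct_fst_snd_mem_algebraicClasses_of_eq (IsK3Surface.isSmoothProjective hSg)
      (IsK3Surface.isSmoothProjective hS) hb ha (rfl : 1 + 1 = 2) _
  refine ⟨c⁻¹ • γ₀, Submodule.smul_mem _ _ hγ₀alg, fun x t hxa => ?_⟩
  -- `pr_S^* x ∪ (pr_{Sg}^* b ∪ pr_S^* a) = pr_{Sg}^* b ∪ pr_S^* (x ∪ a) = t • (pr_{Sg}^* b ∪ pr_S^* p)`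
  have hcomm : cupProduct (rfl : 2 * 1 + 2 * 1 = 2 * 2)
      (complexBetti.map (SemiCartesianMonoidalCategory.snd Sg S) (2 * 1) x)
      (complexBetti.map (SemiCartesianMonoidalCategory.fst Sg S) (2 * 1) b) =
      cupProduct (rfl : 2 * 1 + 2 * 1 = 2 * 2)
        (complexBetti.map (SemiCartesianMonoidalCategory.fst Sg S) (2 * 1) b)
        (complexBetti.map (SemiCartesianMonoidalCategory.snd Sg S) (2 * 1) x) := by
    rw [cupProduct_gradedComm_holds ℂ _ (rfl : 2 * 1 + 2 * 1 = 2 * 2) rfl]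
    norm_num
  have hnat : cupProduct (rfl : 2 * 1 + 2 * 1 = 2 * 2)
      (complexBetti.map (SemiCartesianMonoidalCategory.snd Sg S) (2 * 1) x)
      (complexBetti.map (SemiCartesianMonoidalCategory.snd Sg S) (2 * 1) a) =
      t • complexBetti.map (SemiCartesianMonoidalCategory.snd Sg S) (2 * 2) p := by
    rw [complexBetti.map, complexBetti.map, ← cupProduct_map, hxa, map_smul]
  have h1 : cupProduct (rfl : 2 * 1 + 2 * 2 = 2 * 1 + 2 * 2)
      (complexBetti.map (SemiCartesianMonoidalCategory.snd Sg S) (2 * 1) x) γ₀ =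
      t • cupProduct (rfl : 2 * 1 + 2 * 2 = 2 * 1 + 2 * 2)
        (complexBetti.map (SemiCartesianMonoidalCategory.fst Sg S) (2 * 1) b)
        (complexBetti.map (SemiCartesianMonoidalCategory.snd Sg S) (2 * 2) p) := by
    rw [hγ₀, ← cupProduct_assoc (rfl : 2 * 1 + 2 * 1 = 2 * 2) (rfl : 2 * 1 + 2 * 1 = 2 * 2)
      (rfl : 2 * 2 + 2 * 1 = 2 * 1 + 2 * 2) (rfl : 2 * 1 + 2 * 2 = 2 * 1 + 2 * 2), hcomm,
      cupProduct_assoc (rfl : 2 * 1 + 2 * 1 = 2 * 2) (rfl : 2 * 1 + 2 * 1 = 2 * 2)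
      (rfl : 2 * 2 + 2 * 1 = 2 * 1 + 2 * 2) (rfl : 2 * 1 + 2 * 2 = 2 * 1 + 2 * 2), hnat, map_smul]
  -- projection formula and `pr_{Sg*} pr_S^* p = c · 1`
  have h2 : complexGysin μ
      (IsSmoothProjective.tensor_holds (IsK3Surface.isSmoothProjective hSg)
        (IsK3Surface.isSmoothProjective hS))
      (IsK3Surface.isSmoothProjective hSg) (SemiCartesianMonoidalCategory.fst Sg S)
      (rfl : 2 * 1 + 2 * 2 + 2 * 2 = 2 * 1 + 2 * (2 + 2))
      (cupProduct (rfl : 2 * 1 + 2 * 2 = 2 * 1 + 2 * 2)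
        (complexBetti.map (SemiCartesianMonoidalCategory.fst Sg S) (2 * 1) b)
        (complexBetti.map (SemiCartesianMonoidalCategory.snd Sg S) (2 * 2) p)) = c • b := by
    rw [complexGysin_cup hμ
      (IsSmoothProjective.tensor_holds (IsK3Surface.isSmoothProjective hSg)
        (IsK3Surface.isSmoothProjective hS))
      (IsK3Surface.isSmoothProjective hSg) (SemiCartesianMonoidalCategory.fst Sg S)
      (rfl : 2 * 1 + 2 * 2 = 2 * 1 + 2 * 2) (rfl : 2 * 1 + 2 * 2 + 2 * 2 = 2 * 1 + 2 * (2 + 2))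
      (rfl : 2 * 2 + 2 * 2 = 0 + 2 * (2 + 2)) (rfl : 2 * 1 + 0 = 2 * 1), hκ, map_smul,
      cupProduct_one]
  have hct : c⁻¹ * t * c = t := by field_simp
  rw [map_smul, map_smul, h1, map_smul, h2, smul_smul, smul_smul, hct]

end Summit.HodgeConjecture.HodgeConjecture.Theorems.NikulinTwinTransport

end
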